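import Literature.Combinatorics.StablePolynomials.NegativeCorrelation
import Literature.Combinatorics.StablePolynomials.InsertionFamilies
import Summits.AtomisticToContinuum.BoseEinsteinCondensation.Theorems.InsertionFieldDelocalisation.Negative.Toolkit
import HarnessLib

/-!
# Pinned families of a stable-or-zero coefficient family and the ceiling induction
# (general part of the negative-dependence ceiling for crux
# `BECStronglyRayleigh.InsertionFieldDelocalisation`, stmt-AtomisticToContinuum-9673)

For a real family `a` on the subsets of a finite set whose generating polynomial is
upper-half-plane stable (or `a ≡ 0`): the families pinned at `T`, `S' ↦ [S' ∩ T = ∅] a(S' ∪ T)`,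
are again stable-or-zero (`nac_pinned_stable`, iterated `∂`), hence pairwise negatively
correlated, which in superset form reads `A(T∪{x,t})·A(T) ≤ A(T∪{x})·A(T∪{t})`
(`nac_pinned_nc`, `A(U) = Σ_{S ⊇ U} a S`); for `a ≥ 0` this propagates a one-point identity
`A({x})·V = ν'·A(∅)` at `T = ∅` to the CEILING `A(T∪{x})·V ≤ ν'·A(T)` for all `T`, `x ∉ T`
(`nac_ceiling_induction`, registered handle `stub_pinnedCeilingInduction`). Plus two counting
identities for families supported on `N`-sets (`nac_superset_sum_eq_insert`,
`nac_sum_superset_insert`) and the elementary bound on the flatness functional `K1lhs` under a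
pointwise ceiling (`nac_K1lhs_le`). Used by `…NACeiling` (the crux with `M = N`).
-/

noncomputable section

namespace Summit.AtomisticToContinuum.BoseEinsteinCondensation.Cruxes.InsertionFieldDelocalisation.MobileTrapDirichletEigenfunction

open scoped BigOperators
open Finset
open Summit.AtomisticToContinuum.BoseEinsteinCondensation.Theorems.InsertionFieldDelocalisation.Negative
  (K1lhs K1rhs)
open Literature.Combinatorics.StablePolynomials
  (multiAffine_stableOrZero_derivFamily multiAffine_pairwise_negCorr)

/-! ### Pinned families of a stable-or-zero coefficient family -/
section Pinned

variable {Λ : Type*} [Fintype Λ] [DecidableEq Λ]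

/-- **Re-indexing a pinned sum**: summing `g(S' ∪ T)` over the sets `S'` disjoint from `T` is
summing `g` over the supersets of `T`. [folklore] -/
theorem nac_sum_pinned (g : Finset Λ → ℝ) (T : Finset Λ) :
    ∑ S' : Finset Λ, (if Disjoint S' T then g (S' ∪ T) else 0) =
      ∑ S ∈ univ.filter (fun S : Finset Λ => T ⊆ S), g S := by
  rw [← Finset.sum_filter]
  refine Finset.sum_nbij' (fun S' => S' ∪ T) (fun S => S \ T) ?_ ?_ ?_ ?_ ?_
  · intro S' _
    simp only [mem_filter, mem_univ, true_and]
    exact subset_union_right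
  · intro S _
    simp only [mem_filter, mem_univ, true_and]
    exact sdiff_disjoint
  · intro S' hS'
    simp only [mem_filter, mem_univ, true_and] at hS'
    rw [union_sdiff_right, sdiff_eq_self_of_disjoint hS']
  · intro S hS
    simp only [mem_filter, mem_univ, true_and] at hS
    exact sdiff_union_of_subset hS
  · intro S' _
    rfl

/-- **Pinning keeps "stable or zero"**: if the real family `a` is identically zero or has an
upper-half-plane-stable generating polynomial, so does the family pinned at `T`,
`S' ↦ [S' ∩ T = ∅] · a(S' ∪ T)` (its generating polynomial is the mixed partial `∂_T` of that of
`a`; iterate `multiAffine_stableOrZero_derivFamily`). [folklore] -/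
theorem nac_pinned_stable (a : Finset Λ → ℝ)
    (ha : (∀ S, a S = 0) ∨
      ∀ z : Λ → ℂ, (∀ i, 0 < (z i).im) → (∑ S : Finset Λ, (a S : ℂ) * ∏ i ∈ S, z i) ≠ 0)
    (T : Finset Λ) :
    (∀ S', (if Disjoint S' T then a (S' ∪ T) else 0) = 0) ∨
      ∀ z : Λ → ℂ, (∀ i, 0 < (z i).im) →
        (∑ S' : Finset Λ, ((if Disjoint S' T then a (S' ∪ T) else 0 : ℝ) : ℂ) * ∏ i ∈ S', z i) ≠ 0 := by
  induction T using Finset.induction_on with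
  | empty => simpa using ha
  | @insert t T htT ih =>
    have h := multiAffine_stableOrZero_derivFamily (fun S' => if Disjoint S' T then a (S' ∪ T) else 0) ih t
    have hfun : ∀ S : Finset Λ, (if t ∈ S then (0 : ℝ) else
        if Disjoint (insert t S) T then a (insert t S ∪ T) else 0) =
        if Disjoint S (insert t T) then a (S ∪ insert t T) else 0 := by
      intro S
      by_cases htS : t ∈ S
      · have hnd : ¬ Disjoint S (insert t T) :=
          fun hd => (disjoint_left.1 hd htS) (mem_insert_self t T)
        rw [if_pos htS, if_neg hnd]
      · have hiff : Disjoint (insert t S) T ↔ Disjoint S (insert t T) := by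
          rw [disjoint_insert_left, disjoint_insert_right]
          exact ⟨fun h => ⟨htS, h.2⟩, fun h => ⟨htT, h.2⟩⟩
        have hset : insert t S ∪ T = S ∪ insert t T := by
          ext i; simp only [mem_union, mem_insert]; tauto
        rw [if_neg htS, hset]
        by_cases hd : Disjoint (insert t S) T
        · rw [if_pos hd, if_pos (hiff.1 hd)]
        · rw [if_neg hd, if_neg (fun h' => hd (hiff.2 h'))]
    simp only [hfun] at h
    exact h

/-- **Pairwise negative correlation of the pinned family** in superset form: for `x, t ∉ T`,
`x ≠ t`, `A(T ∪ {x,t}) · A(T) ≤ A(T ∪ {x}) · A(T ∪ {t})` with `A(U) = Σ_{S ⊇ U} a(S)`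
(`multiAffine_pairwise_negCorr` for the pinned family). [folklore] -/
theorem nac_pinned_nc (a : Finset Λ → ℝ)
    (ha : (∀ S, a S = 0) ∨
      ∀ z : Λ → ℂ, (∀ i, 0 < (z i).im) → (∑ S : Finset Λ, (a S : ℂ) * ∏ i ∈ S, z i) ≠ 0)
    {T : Finset Λ} {x t : Λ} (hxT : x ∉ T) (htT : t ∉ T) (hxt : x ≠ t) :
    (∑ S ∈ univ.filter (fun S : Finset Λ => insert x (insert t T) ⊆ S), a S) *
        (∑ S ∈ univ.filter (fun S : Finset Λ => T ⊆ S), a S) ≤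
      (∑ S ∈ univ.filter (fun S : Finset Λ => insert x T ⊆ S), a S) *
        (∑ S ∈ univ.filter (fun S : Finset Λ => insert t T ⊆ S), a S) := by
  have key := multiAffine_pairwise_negCorr (fun S' => if Disjoint S' T then a (S' ∪ T) else 0)
    (nac_pinned_stable a ha T) hxt
  -- convert each of the four pinned sums to superset form
  have conv : ∀ (p : Finset Λ → Prop) [DecidablePred p],
      (∀ S', Disjoint S' T → (p S' ↔ p (S' ∪ T))) →
      ∑ S' ∈ univ.filter p, (if Disjoint S' T then a (S' ∪ T) else 0) =
        ∑ S ∈ univ.filter (fun S : Finset Λ => T ⊆ S), (if p S then a S else 0) := by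
    intro p _ hp
    rw [Finset.sum_filter, ← nac_sum_pinned (fun S => if p S then a S else 0) T]
    refine Finset.sum_congr rfl fun S' _ => ?_
    by_cases hd : Disjoint S' T
    · by_cases hpS : p S'
      · rw [if_pos hpS, if_pos hd, if_pos hd, if_pos ((hp S' hd).1 hpS)]
      · rw [if_neg hpS, if_pos hd, if_neg (fun h => hpS ((hp S' hd).2 h))]
    · by_cases hpS : p S'
      · rw [if_pos hpS, if_neg hd, if_neg hd]
      · rw [if_neg hpS, if_neg hd]
  have filt : ∀ (p : Finset Λ → Prop) [DecidablePred p],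
      ∑ S ∈ univ.filter (fun S : Finset Λ => T ⊆ S), (if p S then a S else 0) =
        ∑ S ∈ univ.filter (fun S : Finset Λ => T ⊆ S ∧ p S), a S := by
    intro p _
    rw [← Finset.sum_filter, Finset.filter_filter]
  have hmemU : ∀ {y : Λ} (S' : Finset Λ), y ∉ T → (y ∈ S' ↔ y ∈ S' ∪ T) := by
    intro y S' hy
    simp only [mem_union]
    exact ⟨Or.inl, fun h => h.elim id fun h' => absurd h' hy⟩
  have e1 : ∑ S' ∈ univ.filter (fun S' : Finset Λ => x ∈ S' ∧ t ∈ S'),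
      (if Disjoint S' T then a (S' ∪ T) else 0) =
      ∑ S ∈ univ.filter (fun S : Finset Λ => insert x (insert t T) ⊆ S), a S := by
    rw [conv (fun S' => x ∈ S' ∧ t ∈ S') (fun S' _ => by rw [hmemU S' hxT, hmemU S' htT]),
      filt]
    refine Finset.sum_congr ?_ fun _ _ => rfl
    ext S
    simp only [mem_filter, mem_univ, true_and, insert_subset_iff]
    tauto
  have e0 : ∑ S' : Finset Λ, (if Disjoint S' T then a (S' ∪ T) else 0) =
      ∑ S ∈ univ.filter (fun S : Finset Λ => T ⊆ S), a S := nac_sum_pinned a T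
  have ex : ∑ S' ∈ univ.filter (fun S' : Finset Λ => x ∈ S'),
      (if Disjoint S' T then a (S' ∪ T) else 0) =
      ∑ S ∈ univ.filter (fun S : Finset Λ => insert x T ⊆ S), a S := by
    rw [conv (fun S' => x ∈ S') (fun S' _ => hmemU S' hxT), filt]
    refine Finset.sum_congr ?_ fun _ _ => rfl
    ext S
    simp only [mem_filter, mem_univ, true_and, insert_subset_iff]
    tauto
  have et : ∑ S' ∈ univ.filter (fun S' : Finset Λ => t ∈ S'),
      (if Disjoint S' T then a (S' ∪ T) else 0) =
      ∑ S ∈ univ.filter (fun S : Finset Λ => insert t T ⊆ S), a S := by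
    rw [conv (fun S' => t ∈ S') (fun S' _ => hmemU S' htT), filt]
    refine Finset.sum_congr ?_ fun _ _ => rfl
    ext S
    simp only [mem_filter, mem_univ, true_and, insert_subset_iff]
    tauto
  rw [e1, e0, ex, et] at key
  exact key

/-- **The ceiling induction**: for a nonnegative stable-or-zero family whose one-point sums
satisfy `A({x}) · V = ν' · A(∅)` for every `x` (translation invariance), pinning only lowers the
one-point ratio: `A(T ∪ {x}) · V ≤ ν' · A(T)` for every `T` and `x ∉ T`. [folklore] -/
theorem nac_ceiling_induction (a : Finset Λ → ℝ) (ha0 : ∀ S, 0 ≤ a S)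
    (ha : (∀ S, a S = 0) ∨
      ∀ z : Λ → ℂ, (∀ i, 0 < (z i).im) → (∑ S : Finset Λ, (a S : ℂ) * ∏ i ∈ S, z i) ≠ 0)
    (V Nn : ℝ) (hNn : 0 ≤ Nn)
    (hbase : ∀ x : Λ, (∑ S ∈ univ.filter (fun S : Finset Λ => ({x} : Finset Λ) ⊆ S), a S) * V =
      Nn * ∑ S : Finset Λ, a S) :
    ∀ (T : Finset Λ) (x : Λ), x ∉ T →
      (∑ S ∈ univ.filter (fun S : Finset Λ => insert x T ⊆ S), a S) * V ≤
        Nn * ∑ S ∈ univ.filter (fun S : Finset Λ => T ⊆ S), a S := by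
  intro T
  induction T using Finset.induction_on with
  | empty =>
    intro x _
    have h1 : (univ.filter fun S : Finset Λ => (∅ : Finset Λ) ⊆ S) = univ :=
      Finset.filter_true_of_mem fun S _ => empty_subset S
    rw [h1, insert_empty]
    exact le_of_eq (hbase x)
  | @insert t T htT ih =>
    intro x hx
    rw [mem_insert, not_or] at hx
    obtain ⟨hxt, hxT⟩ := hx
    have hnc := nac_pinned_nc a ha hxT htT hxt
    have hih := ih x hxT
    have hAT0 : 0 ≤ ∑ S ∈ univ.filter (fun S : Finset Λ => T ⊆ S), a S :=
      Finset.sum_nonneg fun S _ => ha0 S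
    have hAtT0 : 0 ≤ ∑ S ∈ univ.filter (fun S : Finset Λ => insert t T ⊆ S), a S :=
      Finset.sum_nonneg fun S _ => ha0 S
    rcases hAT0.lt_or_eq with hpos | hzero
    · -- divide the product of `hnc` and `hih` by `A(T) > 0`
      by_cases hV : 0 ≤ V
      · have h1 := mul_le_mul_of_nonneg_right hnc hV
        -- A(xtT)·A(T)·V ≤ A(xT)·A(tT)·V = (A(xT)·V)·A(tT) ≤ Nn·A(T)·A(tT)
        have h2 : (∑ S ∈ univ.filter (fun S : Finset Λ => insert x T ⊆ S), a S) *
            (∑ S ∈ univ.filter (fun S : Finset Λ => insert t T ⊆ S), a S) * V ≤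
            Nn * (∑ S ∈ univ.filter (fun S : Finset Λ => T ⊆ S), a S) *
              ∑ S ∈ univ.filter (fun S : Finset Λ => insert t T ⊆ S), a S := by
          have := mul_le_mul_of_nonneg_right hih hAtT0
          nlinarith [this]
        have h3 := h1.trans h2
        -- cancel `A(T) > 0`
        have h4 : ((∑ S ∈ univ.filter (fun S : Finset Λ => insert x (insert t T) ⊆ S), a S) * V) *
            (∑ S ∈ univ.filter (fun S : Finset Λ => T ⊆ S), a S) ≤
            (Nn * ∑ S ∈ univ.filter (fun S : Finset Λ => insert t T ⊆ S), a S) *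
              (∑ S ∈ univ.filter (fun S : Finset Λ => T ⊆ S), a S) := by
          nlinarith [h3]
        exact le_of_mul_le_mul_right h4 hpos
      · -- `V < 0`: the left side is `≤ 0 ≤` the right side
        have hV' : V ≤ 0 := le_of_lt (lt_of_not_ge hV)
        have hl : (∑ S ∈ univ.filter (fun S : Finset Λ => insert x (insert t T) ⊆ S), a S) * V ≤ 0 :=
          mul_nonpos_of_nonneg_of_nonpos (Finset.sum_nonneg fun S _ => ha0 S) hV'
        exact hl.trans (mul_nonneg hNn hAtT0)
    · -- `A(T) = 0`: every `a(S)`, `S ⊇ T`, vanishes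
      have hall : ∀ S, T ⊆ S → a S = 0 := by
        intro S hS
        have := (Finset.sum_eq_zero_iff_of_nonneg (fun S _ => ha0 S)).1 hzero.symm S
          (by simp [hS])
        exact this
      have hl : ∑ S ∈ univ.filter (fun S : Finset Λ => insert x (insert t T) ⊆ S), a S = 0 := by
        refine Finset.sum_eq_zero fun S hS => hall S ?_
        simp only [mem_filter, mem_univ, true_and, insert_subset_iff] at hS
        exact hS.2.2
      rw [hl, zero_mul]
      exact mul_nonneg hNn hAtT0

/-- **One more particle above a pinned `(N-1)`-set**: for a family supported on `N`-sets and
`#U + 1 = N`, `Σ_{S ⊇ U} a(S) = Σ_{y ∉ U} a(U ∪ {y})`. [folklore] -/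
theorem nac_superset_sum_eq_insert (a : Finset Λ → ℝ) (N : ℕ) (ha : ∀ S, a S ≠ 0 → S.card = N)
    {U : Finset Λ} (hU : U.card + 1 = N) :
    ∑ S ∈ univ.filter (fun S : Finset Λ => U ⊆ S), a S =
      ∑ y : Λ, (if y ∈ U then 0 else a (insert y U)) := by
  classical
  -- the right side is the sum of `a` over the image `{insert y U : y ∉ U}`
  have hinj : Set.InjOn (fun y : Λ => insert y U) ↑(univ.filter fun y : Λ => y ∉ U) := by
    intro y hy y' hy' h
    simp only [coe_filter, mem_univ, true_and, Set.mem_setOf_eq] at hy hy'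
    have h' : insert y U = insert y' U := h
    have : y ∈ insert y' U := by rw [← h']; exact mem_insert_self y U
    rcases mem_insert.1 this with h' | h'
    · exact h'
    · exact absurd h' hy
  have hR : ∑ y : Λ, (if y ∈ U then 0 else a (insert y U)) =
      ∑ S ∈ (univ.filter fun y : Λ => y ∉ U).image (fun y => insert y U), a S := by
    rw [Finset.sum_image hinj, ← Finset.sum_filter_add_sum_filter_not univ (fun y : Λ => y ∈ U)]
    rw [Finset.sum_eq_zero (s := univ.filter fun y : Λ => y ∈ U)
      (fun y hy => by rw [mem_filter] at hy; exact if_pos hy.2), zero_add]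
    exact Finset.sum_congr rfl fun y hy => by rw [mem_filter] at hy; exact if_neg hy.2
  rw [hR]
  symm
  refine Finset.sum_subset ?_ ?_
  · intro S hS
    simp only [mem_image, mem_filter, mem_univ, true_and] at hS ⊢
    obtain ⟨y, -, rfl⟩ := hS
    exact subset_insert y U
  · intro S hS hS'
    simp only [mem_filter, mem_univ, true_and] at hS
    by_contra hne
    have hcard := ha S hne
    -- `S ⊇ U` with `#S = #U + 1`: `S = insert y U` for the unique `y ∈ S \ U`
    have hsd : (S \ U).card = 1 := by
      rw [card_sdiff_of_subset hS]; omega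
    obtain ⟨y, hy⟩ := Finset.card_eq_one.1 hsd
    apply hS'
    simp only [mem_image, mem_filter, mem_univ, true_and]
    refine ⟨y, ?_, ?_⟩
    · have : y ∈ S \ U := by rw [hy]; exact mem_singleton_self y
      exact (mem_sdiff.1 this).2
    · rw [← sdiff_union_of_subset hS, hy]
      ext i; simp

/-- **Double counting above a pinned `(N-2)`-set**: for a family supported on `N`-sets and
`#T + 2 = N`, `Σ_{y ∉ T} Σ_{S ⊇ T ∪ {y}} a(S) = 2 · Σ_{S ⊇ T} a(S)`. [folklore] -/
theorem nac_sum_superset_insert (a : Finset Λ → ℝ) (N : ℕ) (ha : ∀ S, a S ≠ 0 → S.card = N)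
    {T : Finset Λ} (hT : T.card + 2 = N) :
    ∑ y : Λ, (if y ∈ T then 0 else ∑ S ∈ univ.filter (fun S : Finset Λ => insert y T ⊆ S), a S) =
      2 * ∑ S ∈ univ.filter (fun S : Finset Λ => T ⊆ S), a S := by
  classical
  have step : ∀ y : Λ, (if y ∈ T then 0 else ∑ S ∈ univ.filter (fun S : Finset Λ => insert y T ⊆ S), a S) =
      ∑ S ∈ univ.filter (fun S : Finset Λ => T ⊆ S), (if y ∉ T ∧ y ∈ S then a S else 0) := by
    intro y
    by_cases hy : y ∈ T
    · rw [if_pos hy]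
      symm
      exact Finset.sum_eq_zero fun S _ => if_neg fun h => h.1 hy
    · rw [if_neg hy, ← Finset.sum_filter, Finset.filter_filter]
      refine Finset.sum_congr ?_ fun _ _ => rfl
      ext S
      simp only [mem_filter, mem_univ, true_and, insert_subset_iff]
      tauto
  rw [Finset.sum_congr rfl fun y _ => step y, Finset.sum_comm, Finset.mul_sum]
  refine Finset.sum_congr rfl fun S hS => ?_
  simp only [mem_filter, mem_univ, true_and] at hS
  rw [← Finset.sum_filter, Finset.sum_const, nsmul_eq_mul]
  by_cases hS0 : a S = 0
  · simp [hS0]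
  · have hcard := ha S hS0
    have hset : (univ.filter fun y : Λ => y ∉ T ∧ y ∈ S) = S \ T := by
      ext y; simp [mem_sdiff, and_comm]
    rw [hset, card_sdiff_of_subset hS]
    have : S.card - T.card = 2 := by omega
    rw [this]
    norm_num

end Pinned

/-! ### The flatness functional under a pointwise ceiling -/
section Functional

variable {ι : Type*} [Fintype ι]

/-- **`K1lhs` under a pointwise ceiling**: if `r ≥ 0` and `2V · r_x ≤ ν'' · Σ_y r_y` for every `x`,
then `V · (Σr³/Σr + (Σr²)²/(Σr)²) ≤ ν'' · Σ r²`. [folklore] -/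
theorem nac_K1lhs_le (r : ι → ℝ) (hr : ∀ x, 0 ≤ r x) (V Nn : ℝ) (hNn : 0 ≤ Nn)
    (h : ∀ x, 2 * V * r x ≤ Nn * ∑ y, r y) :
    V * K1lhs r ≤ Nn * K1rhs r := by
  unfold K1lhs K1rhs
  have hs0 : 0 ≤ ∑ y, r y := Finset.sum_nonneg fun y _ => hr y
  have hq0 : 0 ≤ ∑ y, r y ^ 2 := Finset.sum_nonneg fun y _ => by positivity
  rcases hs0.lt_or_eq with hs | hs
  · -- F1: 2V·Σr³ ≤ ν''·Σr·Σr² ;  F2: 2V·Σr² ≤ ν''·Σr·Σr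
    have F1 : 2 * V * ∑ y, r y ^ 3 ≤ Nn * (∑ y, r y) * ∑ y, r y ^ 2 := by
      have hy : ∀ y, 2 * V * r y ^ 3 ≤ (Nn * ∑ y, r y) * r y ^ 2 := fun y => by
        calc 2 * V * r y ^ 3 = (2 * V * r y) * r y ^ 2 := by ring
          _ ≤ (Nn * ∑ y, r y) * r y ^ 2 := mul_le_mul_of_nonneg_right (h y) (sq_nonneg _)
      calc 2 * V * ∑ y, r y ^ 3 = ∑ y, 2 * V * r y ^ 3 := by rw [Finset.mul_sum]
        _ ≤ ∑ y, (Nn * ∑ y, r y) * r y ^ 2 := Finset.sum_le_sum fun y _ => hy y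
        _ = Nn * (∑ y, r y) * ∑ y, r y ^ 2 := by rw [← Finset.mul_sum]
    have F2 : 2 * V * ∑ y, r y ^ 2 ≤ Nn * (∑ y, r y) * ∑ y, r y := by
      have hy : ∀ y, 2 * V * r y ^ 2 ≤ (Nn * ∑ y, r y) * r y := fun y => by
        calc 2 * V * r y ^ 2 = (2 * V * r y) * r y := by ring
          _ ≤ (Nn * ∑ y, r y) * r y := mul_le_mul_of_nonneg_right (h y) (hr y)
      calc 2 * V * ∑ y, r y ^ 2 = ∑ y, 2 * V * r y ^ 2 := by rw [Finset.mul_sum]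
        _ ≤ ∑ y, (Nn * ∑ y, r y) * r y := Finset.sum_le_sum fun y _ => hy y
        _ = Nn * (∑ y, r y) * ∑ y, r y := by rw [← Finset.mul_sum]
    have hs2 : (0 : ℝ) < (∑ y, r y) ^ 2 := by positivity
    rw [div_add_div _ _ hs.ne' hs2.ne', mul_div_assoc', div_le_iff₀ (by positivity)]
    nlinarith [mul_le_mul_of_nonneg_right F1 hs2.le,
      mul_le_mul_of_nonneg_right F2 (mul_nonneg hq0 hs.le), hq0, hs]
  · -- `Σ r = 0`: the left side vanishes
    rw [← hs]
    simp only [div_zero, zero_pow two_ne_zero, add_zero, mul_zero]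
    exact mul_nonneg hNn hq0

end Functional

/-- **Registered handle** (stub form, `--supports stmt-AtomisticToContinuum-9673`) of the ceiling
induction `nac_ceiling_induction`. [folklore] -/
theorem stub_pinnedCeilingInduction :
    ∀ {Λ : Type} [Fintype Λ] [DecidableEq Λ] (a : Finset Λ → ℝ), (∀ S, 0 ≤ a S) →
      ((∀ S, a S = 0) ∨
        ∀ z : Λ → ℂ, (∀ i, 0 < (z i).im) → (∑ S : Finset Λ, (a S : ℂ) * ∏ i ∈ S, z i) ≠ 0) →
      ∀ (V Nn : ℝ), 0 ≤ Nn →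
      (∀ x : Λ, (∑ S ∈ Finset.univ.filter (fun S : Finset Λ => ({x} : Finset Λ) ⊆ S), a S) * V =
        Nn * ∑ S : Finset Λ, a S) →
      ∀ (T : Finset Λ) (x : Λ), x ∉ T →
        (∑ S ∈ Finset.univ.filter (fun S : Finset Λ => insert x T ⊆ S), a S) * V ≤
          Nn * ∑ S ∈ Finset.univ.filter (fun S : Finset Λ => T ⊆ S), a S :=
  fun a ha0 ha V Nn hNn hbase => nac_ceiling_induction a ha0 ha V Nn hNn hbase

end Summit.AtomisticToContinuum.BoseEinsteinCondensation.Cruxes.InsertionFieldDelocalisation.MobileTrapDirichletEigenfunction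

end
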